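import Literature.Analysis.Pluripotential.LeviForm
import Literature.Analysis.Calculus.AnalyticFlatness
import Literature.Analysis.Complex.PQExtDeriv
import HarnessLib

/-!
# Wirtinger calculus of smooth functions: determinants of smooth matrix functions and the Levi matrix

Topic `Literature/Analysis/Pluripotential`. Smooth (`C^∞`) calculus used by the Monge–Ampère mass
identities of `MongeAmpereMassInvariance.lean` (step (P6) of the proof of
`BoucksomEtAl2010_regularMass_le_degree_pow`, see `NonPluripolarMongeAmpereMass.lean`), stated over
the EXISTING operators `Literature.Analysis.Calculus.dirDeriv` (`D_v f = (w ↦ Df(w) v)`,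
`AnalyticFlatness.lean`), `Literature.Analysis.Complex.dbarAlong` (`∂̄_v`, `CauchyPompeiu.lean`) and
`Literature.Analysis.Complex.delAlong` (`∂_v`, `PQExtDeriv.lean`); no new definitions.

* algebra of `dirDeriv` for `C^∞` functions (`dirDeriv_add/sub/const_mul/div_const/mul/sum`,
  `dirDeriv_ofReal_comp`, `contDiff_dirDeriv`), Schwarz symmetry `dirDeriv_comm`,
  support (`dirDeriv_eq_zero_of_notMem_tsupport`, `hasCompactSupport_dirDeriv`), and
  **`integral_dirDeriv_eq_zero`: `∫ D_v F = 0` for `F` smooth with compact support** (Mathlib's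
  integration by parts `integral_mul_fderiv_eq_neg_fderiv_mul_of_integrable` against `1`);
* `contDiff_det`, **`dirDeriv_det`** — the Leibniz rule for `det M(w)` in COLUMN form
  (`D_v det M = Σ_k det(M with column k differentiated)`, from `Matrix.det_apply'` and
  `HasFDerivAt.finsetProd`), and `dbarAlong_det` (the same along `∂̄_a`);
* for `ℂ`-valued functions on `ℂⁿ`: the bridges `dbarAlong_eq_div`/`delAlong_eq_div`
  (`∂̄_a f = (D_a f + i D_{ia} f)/2`), smoothness of `∂_a f` (`contDiff_delAlong_top`; for `∂̄_a f` use
  `Literature.Analysis.Complex.contDiff_infty_dbarAlong`) and support of `∂̄_a f`, `∂_a f` for `C^∞` `f`,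
  the commutations `dirDeriv_dbarAlong_comm`, `dbarAlong_delAlong_comm`, `dbarAlong_dbarAlong_comm`,
  and **`leviMatrix_eq_delAlong_dbarAlong`: `leviMatrix u w p q = ∂_{e_p} ∂̄_{e_q} u (w)`** for
  `u : ℂⁿ → ℝ` smooth (matching the convention of `BiextensionHeight.leviMatrix`);
* `leviMatrix_add_smul` (`Levi(v + sψ) = Levi v + s Levi ψ`), `leviMatrix_eq_zero_of_notMem_tsupport`,
  `continuous_leviMatrix_apply`, `hasDerivAt_det_add_smul` (`d/ds det(A + sB)`, column expansion).

All statements are standard calculus. [folklore]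
-/

noncomputable section

open scoped Topology ComplexConjugate ContDiff Matrix
open Filter Set Complex MeasureTheory
open Literature.AlgebraicGeometry.HodgeTheory.BiextensionHeight (leviMatrix)
open Literature.Analysis.Calculus (dirDeriv dirDeriv_apply)
open Literature.Analysis.Complex (dbarAlong delAlong dbarAlong_apply delAlong_apply)

namespace Literature.Analysis.Pluripotential

variable {X : Type*} [NormedAddCommGroup X] [NormedSpace ℝ X]
variable {F : Type*} [NormedAddCommGroup F] [NormedSpace ℝ F]
variable {n : ℕ}

/-- `D_v` of a `C^∞` function is `C^∞`. [folklore] -/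
theorem contDiff_dirDeriv {f : X → F} (hf : ContDiff ℝ ∞ f) (v : X) : ContDiff ℝ ∞ (dirDeriv v f) :=
  (hf.fderiv_right le_rfl).clm_apply contDiff_const

/-- Additivity of `D_v`. [folklore] -/
theorem dirDeriv_add {f g : X → F} (hf : ContDiff ℝ ∞ f) (hg : ContDiff ℝ ∞ g) (v : X) :
    dirDeriv v (f + g) = dirDeriv v f + dirDeriv v g := by
  funext w
  simp only [dirDeriv_apply, Pi.add_apply]
  rw [fderiv_add (hf.differentiable (by simp) w) (hg.differentiable (by simp) w)]
  rfl

/-- `D_v (f - g) = D_v f - D_v g`. [folklore] -/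
theorem dirDeriv_sub {f g : X → F} (hf : ContDiff ℝ ∞ f) (hg : ContDiff ℝ ∞ g) (v : X) :
    dirDeriv v (f - g) = dirDeriv v f - dirDeriv v g := by
  funext w
  simp only [dirDeriv_apply, Pi.sub_apply]
  rw [fderiv_sub (hf.differentiable (by simp) w) (hg.differentiable (by simp) w)]
  rfl

/-- `D_v (c f) = c D_v f`. [folklore] -/
theorem dirDeriv_const_mul {f : X → ℂ} (hf : ContDiff ℝ ∞ f) (c : ℂ) (v : X) :
    dirDeriv v (fun w ↦ c * f w) = fun w ↦ c * dirDeriv v f w := by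
  funext w
  simp only [dirDeriv_apply]
  rw [fderiv_const_mul (hf.differentiable (by simp) w)]
  rfl

/-- `D_v (f / c) = D_v f / c`. [folklore] -/
theorem dirDeriv_div_const {f : X → ℂ} (hf : ContDiff ℝ ∞ f) (c : ℂ) (v : X) :
    dirDeriv v (fun w ↦ f w / c) = fun w ↦ dirDeriv v f w / c := by
  funext w
  simp only [dirDeriv_apply, div_eq_mul_inv]
  rw [fderiv_mul_const (hf.differentiable (by simp) w)]
  simp [mul_comm]

/-- Leibniz rule for `D_v`. [folklore] -/
theorem dirDeriv_mul {f g : X → ℂ} (hf : ContDiff ℝ ∞ f) (hg : ContDiff ℝ ∞ g) (v : X) :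
    dirDeriv v (fun w ↦ f w * g w) = fun w ↦ dirDeriv v f w * g w + f w * dirDeriv v g w := by
  funext w
  simp only [dirDeriv_apply]
  rw [fderiv_fun_mul (hf.differentiable (by simp) w) (hg.differentiable (by simp) w)]
  simp only [add_apply, smul_apply, smul_eq_mul]
  ring

/-- Linearity of `D_v f` in `v` (scalars). [folklore] -/
theorem dirDeriv_smul_dir {f : X → F} (a : ℝ) (v : X) :
    dirDeriv (a • v) f = fun w ↦ a • dirDeriv v f w := by
  funext w; simp [dirDeriv_apply, map_smul]

/-- Linearity of `D_v f` in `v` (sums). [folklore] -/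
theorem dirDeriv_add_dir {f : X → F} (v v' : X) :
    dirDeriv (v + v') f = fun w ↦ dirDeriv v f w + dirDeriv v' f w := by
  funext w; simp [dirDeriv_apply, map_add]

/-- Real-valued functions: `D_v (u : ℂ) = (D_v u : ℂ)`. [folklore] -/
theorem dirDeriv_ofReal_comp {u : X → ℝ} (hu : ContDiff ℝ ∞ u) (v : X) :
    dirDeriv v (fun w ↦ (u w : ℂ)) = fun w ↦ ((dirDeriv v u w : ℝ) : ℂ) := by
  funext w
  simp only [dirDeriv_apply]
  rw [show (fun w ↦ (u w : ℂ)) = ofRealCLM ∘ u from rfl,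
    fderiv_comp w ofRealCLM.differentiableAt (hu.differentiable (by simp) w), ofRealCLM.fderiv]
  rfl

/-- `D_v` of a finite sum. [folklore] -/
theorem dirDeriv_sum {ι : Type*} (s : Finset ι) {f : ι → X → ℂ}
    (hf : ∀ i ∈ s, ContDiff ℝ ∞ (f i)) (v : X) :
    dirDeriv v (fun w ↦ ∑ i ∈ s, f i w) = fun w ↦ ∑ i ∈ s, dirDeriv v (f i) w := by
  funext w
  simp only [dirDeriv_apply]
  rw [fderiv_fun_sum fun i hi ↦ (hf i hi).differentiable (by simp) w]
  simp only [FunLike.coe_sum, Finset.sum_apply]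

/-- Second directional derivatives through the second Fréchet derivative. [folklore] -/
theorem dirDeriv_dirDeriv_apply {f : X → F} (hf : ContDiff ℝ ∞ f) (a b w : X) :
    dirDeriv a (dirDeriv b f) w = fderiv ℝ (fderiv ℝ f) w a b := by
  have hd : DifferentiableAt ℝ (fderiv ℝ f) w :=
    ((hf.fderiv_right (m := ∞) le_rfl).differentiable (by simp)) w
  unfold dirDeriv
  rw [fderiv_clm_apply hd (differentiableAt_const b)]
  simp

/-- `D_a D_b f = D_b D_a f` for `C^∞` functions. [folklore] -/
theorem dirDeriv_comm {f : X → F} (hf : ContDiff ℝ ∞ f) (a b : X) :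
    dirDeriv a (dirDeriv b f) = dirDeriv b (dirDeriv a f) := by
  funext w
  have h2 : ContDiffAt ℝ 2 f w := hf.contDiffAt.of_le (WithTop.coe_le_coe.mpr le_top)
  rw [dirDeriv_dirDeriv_apply hf, dirDeriv_dirDeriv_apply hf, h2.isSymmSndFDerivAt (by simp) a b]

/-- If `f` vanishes off a closed set... `D_v f` is supported in `tsupport f`. [folklore] -/
theorem dirDeriv_eq_zero_of_notMem_tsupport {f : X → F} (v : X) {w : X} (hw : w ∉ tsupport f) :
    dirDeriv v f w = 0 := by
  simp only [dirDeriv_apply]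
  rw [fderiv_of_notMem_tsupport ℝ hw]
  rfl

/-! ### Determinants of smooth matrix functions -/

/-- The determinant of an entrywise `C^∞` matrix function is `C^∞`. [folklore] -/
theorem contDiff_det {M : X → Matrix (Fin n) (Fin n) ℂ}
    (hM : ∀ i j, ContDiff ℝ ∞ fun w ↦ M w i j) : ContDiff ℝ ∞ fun w ↦ (M w).det := by
  simp only [Matrix.det_apply']
  exact ContDiff.sum fun σ _ ↦ contDiff_const.mul (contDiff_prod fun i _ ↦ hM _ _)

/-- **Leibniz rule for determinants, column form**: the directional derivative of `det M(w)` is the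
sum over `k` of the determinants obtained by differentiating the `k`-th column. [folklore] -/
theorem dirDeriv_det {M : X → Matrix (Fin n) (Fin n) ℂ}
    (hM : ∀ i j, ContDiff ℝ ∞ fun w ↦ M w i j) (v : X) :
    dirDeriv v (fun w ↦ (M w).det) =
      fun w ↦ ∑ k, ((M w).updateCol k fun i ↦ dirDeriv v (fun w ↦ M w i k) w).det := by
  funext w
  have h1 : (fun w ↦ (M w).det) =
      fun w ↦ ∑ σ : Equiv.Perm (Fin n), ((Equiv.Perm.sign σ : ℤ) : ℂ) * ∏ i, M w (σ i) i := by
    funext w; rw [Matrix.det_apply']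
  rw [h1, dirDeriv_sum _ (fun σ _ ↦ contDiff_const.mul (contDiff_prod fun i _ ↦ hM _ _))]
  have h2 : ∀ σ : Equiv.Perm (Fin n),
      dirDeriv v (fun w ↦ ((Equiv.Perm.sign σ : ℤ) : ℂ) * ∏ i, M w (σ i) i) w =
        ((Equiv.Perm.sign σ : ℤ) : ℂ) *
          ∑ k, (∏ i ∈ Finset.univ.erase k, M w (σ i) i) * dirDeriv v (fun w ↦ M w (σ k) k) w := by
    intro σ
    rw [dirDeriv_const_mul (contDiff_prod fun i _ ↦ hM _ _)]
    simp only [dirDeriv_apply]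
    rw [(HasFDerivAt.finsetProd (u := Finset.univ)
      (fun i _ ↦ ((hM (σ i) i).differentiable (by simp) w).hasFDerivAt)).fderiv]
    simp only [FunLike.coe_sum, Finset.sum_apply, smul_apply, smul_eq_mul]
  simp only [h2, Finset.mul_sum, Matrix.det_apply', Matrix.updateCol_apply]
  rw [Finset.sum_comm]
  refine Finset.sum_congr rfl fun k _ ↦ Finset.sum_congr rfl fun σ _ ↦ ?_
  congr 1
  rw [← Finset.mul_prod_erase Finset.univ _ (Finset.mem_univ k), if_pos rfl,
    mul_comm (∏ i ∈ Finset.univ.erase k, M w (σ i) i)]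
  congr 1
  exact Finset.prod_congr rfl fun i hi ↦ (if_neg (Finset.ne_of_mem_erase hi)).symm

/-! ### Wirtinger derivatives (`Literature.Analysis.Complex.dbarAlong/delAlong`) on `ℂ`-valued functions -/

/-- `∂̄_v f = (D_v f + i D_{iv} f)/2` for `ℂ`-valued `f` (bridge to `dbarAlong`). [folklore] -/
theorem dbarAlong_eq_div (v : Fin n → ℂ) (f : (Fin n → ℂ) → ℂ) (w : Fin n → ℂ) :
    dbarAlong v f w = (dirDeriv v f w + I * dirDeriv (I • v) f w) / 2 := by
  simp only [dbarAlong_apply, dirDeriv_apply, smul_eq_mul]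
  ring

/-- `∂_v f = (D_v f - i D_{iv} f)/2` for `ℂ`-valued `f` (bridge to `delAlong`). [folklore] -/
theorem delAlong_eq_div (v : Fin n → ℂ) (f : (Fin n → ℂ) → ℂ) (w : Fin n → ℂ) :
    delAlong v f w = (dirDeriv v f w - I * dirDeriv (I • v) f w) / 2 := by
  simp only [delAlong_apply, dirDeriv_apply, smul_eq_mul]
  ring

/-- Function form of `dbarAlong_eq_div`. [folklore] -/
theorem dbarAlong_eq_fun (v : Fin n → ℂ) (f : (Fin n → ℂ) → ℂ) :
    dbarAlong v f = fun w ↦ (dirDeriv v f w + I * dirDeriv (I • v) f w) / 2 :=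
  funext (dbarAlong_eq_div v f)

/-- Function form of `delAlong_eq_div`. [folklore] -/
theorem delAlong_eq_fun (v : Fin n → ℂ) (f : (Fin n → ℂ) → ℂ) :
    delAlong v f = fun w ↦ (dirDeriv v f w - I * dirDeriv (I • v) f w) / 2 :=
  funext (delAlong_eq_div v f)

/-- `∂_a` of a `C^∞` function is `C^∞` (for `∂̄_a` this is
`Literature.Analysis.Complex.contDiff_infty_dbarAlong`, `DbarAlongCalculus.lean`). [folklore] -/
theorem contDiff_delAlong_top {f : (Fin n → ℂ) → ℂ} (hf : ContDiff ℝ ∞ f) (a : Fin n → ℂ) :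
    ContDiff ℝ ∞ (delAlong a f) := by
  rw [delAlong_eq_fun]
  exact ((contDiff_dirDeriv hf _).sub (contDiff_const.mul (contDiff_dirDeriv hf _))).div_const 2

/-- `∂̄_a f` vanishes off `tsupport f`. [folklore] -/
theorem dbarAlong_eq_zero_of_notMem_tsupport {f : (Fin n → ℂ) → ℂ} (a : Fin n → ℂ)
    {w : Fin n → ℂ} (hw : w ∉ tsupport f) : dbarAlong a f w = 0 := by
  rw [dbarAlong_eq_div, dirDeriv_eq_zero_of_notMem_tsupport _ hw,
    dirDeriv_eq_zero_of_notMem_tsupport _ hw]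
  simp

/-- `∂_a f` vanishes off `tsupport f`. [folklore] -/
theorem delAlong_eq_zero_of_notMem_tsupport {f : (Fin n → ℂ) → ℂ} (a : Fin n → ℂ)
    {w : Fin n → ℂ} (hw : w ∉ tsupport f) : delAlong a f w = 0 := by
  rw [delAlong_eq_div, dirDeriv_eq_zero_of_notMem_tsupport _ hw,
    dirDeriv_eq_zero_of_notMem_tsupport _ hw]
  simp

/-- `tsupport (∂̄_a f) ⊆ tsupport f`. [folklore] -/
theorem tsupport_dbarAlong_subset (a : Fin n → ℂ) (f : (Fin n → ℂ) → ℂ) :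
    tsupport (dbarAlong a f) ⊆ tsupport f :=
  closure_minimal (fun _ hw ↦ by_contra fun h ↦ hw (dbarAlong_eq_zero_of_notMem_tsupport a h))
    (isClosed_tsupport f)

/-- `tsupport (∂_a f) ⊆ tsupport f`. [folklore] -/
theorem tsupport_delAlong_subset (a : Fin n → ℂ) (f : (Fin n → ℂ) → ℂ) :
    tsupport (delAlong a f) ⊆ tsupport f :=
  closure_minimal (fun _ hw ↦ by_contra fun h ↦ hw (delAlong_eq_zero_of_notMem_tsupport a h))
    (isClosed_tsupport f)

/-- `D_b ∂̄_a = ∂̄_a D_b` on `C^∞` functions. [folklore] -/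
theorem dirDeriv_dbarAlong_comm {f : (Fin n → ℂ) → ℂ} (hf : ContDiff ℝ ∞ f) (b a : Fin n → ℂ) :
    dirDeriv b (dbarAlong a f) = dbarAlong a (dirDeriv b f) := by
  have h1 := contDiff_dirDeriv hf a
  have h2 := contDiff_dirDeriv hf (I • a)
  rw [dbarAlong_eq_fun, dbarAlong_eq_fun, dirDeriv_div_const (h1.add (contDiff_const.mul h2)),
    show (fun w ↦ dirDeriv a f w + I * dirDeriv (I • a) f w) =
      dirDeriv a f + fun w ↦ I * dirDeriv (I • a) f w from rfl,
    dirDeriv_add h1 (contDiff_const.mul h2), dirDeriv_const_mul h2,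
    dirDeriv_comm hf b a, dirDeriv_comm hf b (I • a)]
  rfl

/-- `D_b ∂_a = ∂_a D_b` on `C^∞` functions. [folklore] -/
theorem dirDeriv_delAlong_comm {f : (Fin n → ℂ) → ℂ} (hf : ContDiff ℝ ∞ f) (b a : Fin n → ℂ) :
    dirDeriv b (delAlong a f) = delAlong a (dirDeriv b f) := by
  have h1 := contDiff_dirDeriv hf a
  have h2 := contDiff_dirDeriv hf (I • a)
  rw [delAlong_eq_fun, delAlong_eq_fun, dirDeriv_div_const (h1.sub (contDiff_const.mul h2)),
    show (fun w ↦ dirDeriv a f w - I * dirDeriv (I • a) f w) =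
      dirDeriv a f - fun w ↦ I * dirDeriv (I • a) f w from rfl,
    dirDeriv_sub h1 (contDiff_const.mul h2), dirDeriv_const_mul h2,
    dirDeriv_comm hf b a, dirDeriv_comm hf b (I • a)]
  rfl

/-- `∂̄_a ∂_b = ∂_b ∂̄_a` on `C^∞` functions. [folklore] -/
theorem dbarAlong_delAlong_comm {f : (Fin n → ℂ) → ℂ} (hf : ContDiff ℝ ∞ f) (a b : Fin n → ℂ) :
    dbarAlong a (delAlong b f) = delAlong b (dbarAlong a f) := by
  funext w
  have e1 : dbarAlong a (delAlong b f) w = (delAlong b (dirDeriv a f) w +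
      I * delAlong b (dirDeriv (I • a) f) w) / 2 := by
    rw [dbarAlong_eq_div, dirDeriv_delAlong_comm hf, dirDeriv_delAlong_comm hf]
  have e2 : delAlong b (dbarAlong a f) w = (dbarAlong a (dirDeriv b f) w -
      I * dbarAlong a (dirDeriv (I • b) f) w) / 2 := by
    rw [delAlong_eq_div, dirDeriv_dbarAlong_comm hf, dirDeriv_dbarAlong_comm hf]
  rw [e1, e2]
  simp only [delAlong_eq_div, dbarAlong_eq_div]
  rw [congr_fun (dirDeriv_comm hf b a) w, congr_fun (dirDeriv_comm hf b (I • a)) w,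
    congr_fun (dirDeriv_comm hf (I • b) a) w, congr_fun (dirDeriv_comm hf (I • b) (I • a)) w]
  ring

/-- `∂̄_a ∂̄_b = ∂̄_b ∂̄_a` on `C^∞` functions. [folklore] -/
theorem dbarAlong_dbarAlong_comm {f : (Fin n → ℂ) → ℂ} (hf : ContDiff ℝ ∞ f) (a b : Fin n → ℂ) :
    dbarAlong a (dbarAlong b f) = dbarAlong b (dbarAlong a f) := by
  funext w
  have e1 : dbarAlong a (dbarAlong b f) w = (dbarAlong b (dirDeriv a f) w +
      I * dbarAlong b (dirDeriv (I • a) f) w) / 2 := by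
    rw [dbarAlong_eq_div, dirDeriv_dbarAlong_comm hf, dirDeriv_dbarAlong_comm hf]
  have e2 : dbarAlong b (dbarAlong a f) w = (dbarAlong a (dirDeriv b f) w +
      I * dbarAlong a (dirDeriv (I • b) f) w) / 2 := by
    rw [dbarAlong_eq_div, dirDeriv_dbarAlong_comm hf, dirDeriv_dbarAlong_comm hf]
  rw [e1, e2]
  simp only [dbarAlong_eq_div]
  rw [congr_fun (dirDeriv_comm hf b a) w, congr_fun (dirDeriv_comm hf b (I • a)) w,
    congr_fun (dirDeriv_comm hf (I • b) a) w, congr_fun (dirDeriv_comm hf (I • b) (I • a)) w]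
  ring

/-- **The Levi matrix through Wirtinger derivatives**: for `u : ℂⁿ → ℝ` of class `C^∞`,
`leviMatrix u w p q = ∂_p ∂̄_q u (w)` (`∂_p = delAlong e_p`, `∂̄_q = dbarAlong e_q`). [folklore] -/
theorem leviMatrix_eq_delAlong_dbarAlong {u : (Fin n → ℂ) → ℝ} (hu : ContDiff ℝ ∞ u)
    (w : Fin n → ℂ) (p q : Fin n) :
    leviMatrix u w p q =
      delAlong (Pi.single p 1) (dbarAlong (Pi.single q 1) (fun w ↦ (u w : ℂ))) w := by
  rw [leviMatrix_apply]
  have hU : ContDiff ℝ ∞ (fun w ↦ (u w : ℂ)) := ofRealCLM.contDiff.comp hu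
  have key : ∀ a b : Fin n → ℂ, dirDeriv a (dirDeriv b (fun w ↦ (u w : ℂ))) w =
      ((fderiv ℝ (fderiv ℝ u) w a b : ℝ) : ℂ) := by
    intro a b
    rw [dirDeriv_ofReal_comp hu, dirDeriv_ofReal_comp (contDiff_dirDeriv hu b)]
    beta_reduce
    rw [dirDeriv_dirDeriv_apply hu]
  have e : delAlong (Pi.single p 1) (dbarAlong (Pi.single q 1) (fun w ↦ (u w : ℂ))) w =
      (dbarAlong (Pi.single q 1) (dirDeriv (Pi.single p 1) (fun w ↦ (u w : ℂ))) w -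
        I * dbarAlong (Pi.single q 1) (dirDeriv (I • Pi.single p 1) (fun w ↦ (u w : ℂ))) w) / 2 := by
    rw [delAlong_eq_div, dirDeriv_dbarAlong_comm hU, dirDeriv_dbarAlong_comm hU]
  rw [e]
  simp only [dbarAlong_eq_div]
  rw [congr_fun (dirDeriv_comm hU (Pi.single q 1) (Pi.single p 1)) w,
    congr_fun (dirDeriv_comm hU (I • Pi.single q 1) (Pi.single p 1)) w,
    congr_fun (dirDeriv_comm hU (Pi.single q 1) (I • Pi.single p 1)) w,
    congr_fun (dirDeriv_comm hU (I • Pi.single q 1) (I • Pi.single p 1)) w,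
    key, key, key, key]
  push_cast
  ring_nf
  rw [Complex.I_sq]
  ring

/-- **Leibniz rule for determinants along `∂̄_a`** (column form). [folklore] -/
theorem dbarAlong_det {M : (Fin n → ℂ) → Matrix (Fin n) (Fin n) ℂ}
    (hM : ∀ i j, ContDiff ℝ ∞ fun w ↦ M w i j) (a : Fin n → ℂ) :
    dbarAlong a (fun w ↦ (M w).det) =
      fun w ↦ ∑ k, ((M w).updateCol k fun i ↦ dbarAlong a (fun w ↦ M w i k) w).det := by
  funext w
  simp only [dbarAlong_eq_div, dirDeriv_det hM]
  rw [Finset.mul_sum, ← Finset.sum_add_distrib, Finset.sum_div]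
  refine Finset.sum_congr rfl fun k _ ↦ ?_
  rw [← Matrix.det_updateCol_smul, ← Matrix.det_updateCol_add, div_eq_mul_inv, mul_comm,
    ← Matrix.det_updateCol_smul]
  congr 1
  ext i j
  simp only [Matrix.updateCol_apply, Pi.add_apply, Pi.smul_apply, smul_eq_mul]
  split_ifs <;> ring

section Integral

/-- `D_v` preserves compact support. [folklore] -/
theorem hasCompactSupport_dirDeriv {f : X → F} (hf : HasCompactSupport f) (v : X) :
    HasCompactSupport (dirDeriv v f) :=
  hf.fderiv_apply (𝕜 := ℝ) v

variable [MeasurableSpace X] [BorelSpace X] [FiniteDimensional ℝ X]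
  {μ : Measure X} [μ.IsAddHaarMeasure]

/-- **The integral of a directional derivative of a compactly supported `C^∞` function vanishes**
(`C¹` would do; stated for the smooth functions used here). [folklore] -/
theorem integral_dirDeriv_eq_zero {f : X → ℂ} (hf : ContDiff ℝ ∞ f) (hfc : HasCompactSupport f)
    (v : X) : ∫ w, dirDeriv v f w ∂μ = 0 := by
  have hcont : Continuous (fun x ↦ fderiv ℝ f x v) :=
    ((hf.fderiv_right (m := ∞) le_rfl).clm_apply contDiff_const).continuous
  have hint : Integrable (fun x ↦ fderiv ℝ f x v) μ :=
    hcont.integrable_of_hasCompactSupport (hfc.fderiv_apply (𝕜 := ℝ) v)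
  have h := integral_mul_fderiv_eq_neg_fderiv_mul_of_integrable (μ := μ) (f := fun _ : X ↦ (1 : ℂ))
    (g := f) (v := v) (by simp) (by simpa only [one_mul] using hint)
    (by simpa using hf.continuous.integrable_of_hasCompactSupport hfc)
    (fun _ _ ↦ differentiableAt_const _) (fun x _ ↦ hf.differentiable (by simp) x)
  simpa [dirDeriv] using h


end Integral

/-! ### The Levi matrix of smooth functions: linearity, support -/

section LeviSmooth

variable {n : ℕ}

/-- Linearity of the Levi matrix along a pencil of smooth functions:
`Levi(v + s ψ) = Levi(v) + s Levi(ψ)`. [folklore] -/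
theorem leviMatrix_add_smul {v ψ : (Fin n → ℂ) → ℝ} (hv : ContDiff ℝ ∞ v) (hψ : ContDiff ℝ ∞ ψ)
    (s : ℝ) (w : Fin n → ℂ) :
    leviMatrix (v + s • ψ) w = leviMatrix v w + (s : ℂ) • leviMatrix ψ w := by
  ext p q
  have h2v : ContDiff ℝ 2 v := hv.of_le (WithTop.coe_le_coe.mpr le_top)
  have h2ψ : ContDiff ℝ 2 ψ := hψ.of_le (WithTop.coe_le_coe.mpr le_top)
  have key : ∀ m : Fin 2 → (Fin n → ℂ), iteratedFDeriv ℝ 2 (v + s • ψ) w m =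
      iteratedFDeriv ℝ 2 v w m + s * iteratedFDeriv ℝ 2 ψ w m := by
    intro m
    rw [iteratedFDeriv_add_apply h2v.contDiffAt
        (show ContDiffAt ℝ 2 (s • ψ) w from (h2ψ.const_smul s).contDiffAt),
      iteratedFDeriv_const_smul_apply h2ψ.contDiffAt]
    simp
  simp only [leviMatrix, Matrix.add_apply, Matrix.smul_apply, key, smul_eq_mul]
  push_cast
  ring

/-- The Levi matrix of `ψ` vanishes off `tsupport ψ`. [folklore] -/
theorem leviMatrix_eq_zero_of_notMem_tsupport {ψ : (Fin n → ℂ) → ℝ} {w : Fin n → ℂ}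
    (hw : w ∉ tsupport ψ) : leviMatrix ψ w = 0 := by
  have h0 : iteratedFDeriv ℝ 2 ψ w = 0 :=
    Function.notMem_support.mp fun h ↦ hw (support_iteratedFDeriv_subset (n := 2) h)
  ext p q
  simp [leviMatrix, h0]

/-- The entries of the Levi matrix of a `C^∞` function are continuous. [folklore] -/
theorem continuous_leviMatrix_apply {u : (Fin n → ℂ) → ℝ} (hu : ContDiff ℝ ∞ u) (p q : Fin n) :
    Continuous fun w ↦ leviMatrix u w p q := by
  have hc : ∀ m : Fin 2 → (Fin n → ℂ), Continuous fun w ↦ iteratedFDeriv ℝ 2 u w m := fun m ↦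
    (continuous_eval_const m).comp
      (hu.continuous_iteratedFDeriv (m := 2) (WithTop.coe_le_coe.mpr le_top))
  simp only [leviMatrix]
  fun_prop

/-- **Derivative of `s ↦ det (A + s B)`** (column expansion). [folklore] -/
theorem hasDerivAt_det_add_smul (A B : Matrix (Fin n) (Fin n) ℂ) (s : ℝ) :
    HasDerivAt (fun s : ℝ ↦ (A + (s : ℂ) • B).det)
      (∑ k, ((A + (s : ℂ) • B).updateCol k fun i ↦ B i k).det) s := by
  set M : ℝ → Matrix (Fin n) (Fin n) ℂ := fun s ↦ A + (s : ℂ) • B with hM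
  have hMs : ∀ i j, ContDiff ℝ ∞ fun s ↦ M s i j := by
    intro i j
    simp only [hM, Matrix.add_apply, Matrix.smul_apply, smul_eq_mul]
    exact contDiff_const.add ((ofRealCLM.contDiff).mul contDiff_const)
  have hderiv : ∀ i k, dirDeriv (1 : ℝ) (fun s ↦ M s i k) s = B i k := by
    intro i k
    have h : HasDerivAt (fun s : ℝ ↦ M s i k) (B i k) s := by
      simp only [hM, Matrix.add_apply, Matrix.smul_apply, smul_eq_mul]
      simpa using ((hasDerivAt_id s).ofReal_comp.mul_const (B i k)).const_add (A i k)
    rw [dirDeriv_apply, ← h.deriv, fderiv_apply_one_eq_deriv]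
  have hdet := congr_fun (dirDeriv_det hMs (1 : ℝ)) s
  simp only [hderiv] at hdet
  have hdiff : DifferentiableAt ℝ (fun s ↦ (M s).det) s :=
    (contDiff_det hMs).differentiable (by simp) s
  have := hdiff.hasDerivAt
  rwa [← fderiv_apply_one_eq_deriv, show fderiv ℝ (fun s ↦ (M s).det) s 1 = dirDeriv (1 : ℝ) (fun s ↦ (M s).det) s
    from rfl, hdet] at this

end LeviSmooth


end Literature.Analysis.Pluripotential

end
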